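import Summits.AtomisticToContinuum.HydrodynamicLimit.Theses.OneFlightGossipEngine
import Summits.AtomisticToContinuum.HydrodynamicLimit.Theorems.ShearStressHalfDrude.Negative.WithoutOrth
import Summits.AtomisticToContinuum.HydrodynamicLimit.Theorems.BoltzmannGreenKubo.Negative.ForallN
import Summits.AtomisticToContinuum.HydrodynamicLimit.Theorems.KineticFluxLdDecay.Negative.TiltBasics
import Literature.Analysis.FluidPDE.HardSphereAlexander
import Literature.Analysis.FluidPDE.HardSphereDynamicsProofs
import Literature.Analysis.FunctionSpaces.BMOCarlesonProofs
import Summits.AtomisticToContinuum.HydrodynamicLimit.Theorems.AprioriBounds.Negative.ExpMomentTangent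

/-!
# Window functionals under the drifted homogeneous Gibbs law (crux `KineticCurrentsWindowLDUniform`, 1/3)

Negative-knowledge infrastructure for the crux `OneFlightGossipEngine.KineticCurrentsWindowLDUniform`
(stmt-AtomisticToContinuum-14662), from the standing disprover's `Cruxes/KineticCurrentsWindowLDUniform/Disproof.lean`
§ 3; part 1 of `Negative/{WindowFubini, WindowSum, TiltWindow, LoadBearing}`. For the kinetic-window functional
`W(z) = ∑ᵢ w⁻¹ ∫₀ʷ g(vᵢ(r)) dr` of a continuous one-body velocity observable `g` of POLYNOMIAL growth
`|g| ≤ C(1 + ‖v‖²)^m` (the crux's class is `m = 1`: traceless stress + truncated heat flux; the true heat flux is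
`m = 2`) along ANY hard-sphere flow:
(A) Fubini in time + stationarity for INTEGRABLE (not only bounded) observables under the homogeneous Gibbs law
with constant drift, `∫ (∫₀ʰ f(Φ_s z) ds) dG_N = h ∫ f dG_N` (`integral_window_eq_of_integrable`; the bounded case
is `ShearStressHalfDrudeNonCentred.integral_window_eq`); (B) one-body reductions to `gaussMeasure u θ`
(`lintegral/integral_vel_localGibbsMeasure_const`, `measurePreserving_vel_localGibbsMeasure_const`) and Gibbs
integrability of polynomially bounded observables and of powers of the kinetic energy; (C, file `WindowSum`) the window functional `windowSum` and its mean under the drifted Gibbs law; part 3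
(`TiltWindow`) turns this into the Donsker–Varadhan drift-tilt lower bound.
refuter-cdisprove-stmt-AtomisticToContinuum-14662-0.
-/

noncomputable section

namespace Summit.AtomisticToContinuum.HydrodynamicLimit.Theorems
namespace KineticCurrentsWindowTilt

open MeasureTheory ProbabilityTheory Filter Set Topology Real
open scoped ENNReal NNReal InnerProductSpace
open Literature.MathematicalPhysics.KineticTheory Literature.Analysis.FluidPDE

/-! ### A. Fubini in time + stationarity for INTEGRABLE observables -/

/-- **Mean of a window integral under the stationary Gibbs law, integrable observables**: for constant
profiles, every flow, every window `h > 0` and every measurable `f` that is INTEGRABLE under the Gibbs law,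
`∫ (∫₀ʰ f(Φ_s z) ds) dG_N = h ∫ f dG_N` (joint measurability of the flow on its good set, Tonelli +
invariance for the integrability of the uncurried integrand, Fubini, and `(Φ_s)_# G_N = G_N`). The bounded
case is `ShearStressHalfDrudeNonCentred.integral_window_eq`. [folklore] -/
theorem integral_window_eq_of_integrable (σ a θ : ℝ) (u : V3) (N : ℕ)
    (Φ : HardSphereFlow (Torus.geometry (Fin 3)) (hsDiameter σ N) (N + 1))
    [IsFiniteMeasure (localGibbsLaw σ (fun _ => a) (fun _ => u) (fun _ => θ) N Φ)]
    {f : Config (N + 1) (Fin 3) T3 → ℝ} (hf : Measurable f)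
    (hfi : Integrable f (localGibbsLaw σ (fun _ => a) (fun _ => u) (fun _ => θ) N Φ))
    {h : ℝ} (hh : 0 < h) :
    ∫ z, (∫ s in (0 : ℝ)..h, f (Φ.flow s z)) ∂(localGibbsLaw σ (fun _ => a) (fun _ => u) (fun _ => θ) N Φ) =
      h * ∫ z, f z ∂(localGibbsLaw σ (fun _ => a) (fun _ => u) (fun _ => θ) N Φ) := by
  set μ := localGibbsLaw σ (fun _ => a) (fun _ => u) (fun _ => θ) N Φ with hμ
  set ν : Measure ℝ := volume.restrict (Ioc (0 : ℝ) h) with hν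
  haveI : IsFiniteMeasure ν := by
    rw [hν]; exact isFiniteMeasure_restrict.2 (by simp)
  -- the law is carried by the good set
  have hac : μ ≪ liouville (Torus.geometry (Fin 3)) (N + 1) (hsDiameter σ N) :=
    withDensity_absolutelyContinuous _ _
  have hgood : μ Φ.goodᶜ = 0 := hac Φ.measure_compl_good
  -- a measurable modification of the uncurried integrand
  set S : Set (Config (N + 1) (Fin 3) T3 × ℝ) := Φ.good ×ˢ (univ : Set ℝ) with hS
  have hSm : MeasurableSet S := Φ.measurableSet_good.prod MeasurableSet.univ
  have hflowS : Measurable fun p : S => f (Φ.flow p.1.2 p.1.1) := by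
    have hmk : Measurable fun p : S => ((⟨p.1.1, (mem_prod.1 p.2).1⟩ : Φ.good), p.1.2) :=
      ((measurable_fst.comp measurable_subtype_coe).subtype_mk).prodMk
        (measurable_snd.comp measurable_subtype_coe)
    exact hf.comp ((Φ.measurable_flow_prod_torus).comp hmk)
  classical
  set G : Config (N + 1) (Fin 3) T3 × ℝ → ℝ := fun p =>
    if hp : p ∈ S then f (Φ.flow p.2 p.1) else 0 with hG
  have hGm : Measurable G := by
    have := Measurable.dite (s := S) (f := fun p : S => f (Φ.flow p.1.2 p.1.1))
      (g := fun _ => (0 : ℝ)) hflowS measurable_const hSm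
    convert this using 1
  -- pointwise: `‖G (z, s)‖ₑ ≤ ‖f (Φ_s z)‖ₑ`
  have hGle : ∀ p, ‖G p‖ₑ ≤ ‖f (Φ.flow p.2 p.1)‖ₑ := by
    intro p
    by_cases hp : p ∈ S
    · simp only [hG, hp, dite_true]; exact le_rfl
    · simp only [hG, hp, dite_false, enorm_zero]; exact bot_le
  -- integrability of `G` on the product: Tonelli + invariance
  have hGint : Integrable G (μ.prod ν) := by
    refine ⟨hGm.aestronglyMeasurable, ?_⟩
    rw [HasFiniteIntegral, lintegral_prod_symm _ hGm.enorm.aemeasurable]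
    have hinner : ∀ s, ∫⁻ z, ‖G (z, s)‖ₑ ∂μ ≤ ∫⁻ z, ‖f z‖ₑ ∂μ := by
      intro s
      calc ∫⁻ z, ‖G (z, s)‖ₑ ∂μ ≤ ∫⁻ z, ‖f (Φ.flow s z)‖ₑ ∂μ := lintegral_mono fun z => hGle (z, s)
        _ = ∫⁻ z, ‖f z‖ₑ ∂μ :=
            lintegral_comp_flow_localGibbsLaw_const σ a θ u N Φ s (g := fun z => ‖f z‖ₑ) hf.enorm
    calc ∫⁻ s, ∫⁻ z, ‖G (z, s)‖ₑ ∂μ ∂ν ≤ ∫⁻ _s, ∫⁻ z, ‖f z‖ₑ ∂μ ∂ν := lintegral_mono hinner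
      _ = (∫⁻ z, ‖f z‖ₑ ∂μ) * ν univ := lintegral_const _
      _ < ⊤ := ENNReal.mul_lt_top hfi.2 (measure_lt_top _ _)
  -- the uncurried integrand agrees with `G` almost everywhere
  have hSc : (μ.prod ν) Sᶜ = 0 := by
    have hsub : Sᶜ ⊆ Φ.goodᶜ ×ˢ (univ : Set ℝ) := by
      intro p hp
      simp only [hS, mem_compl_iff, mem_prod, mem_univ, and_true] at hp
      exact ⟨hp, mem_univ _⟩
    refine measure_mono_null hsub ?_
    rw [Measure.prod_prod, hgood, zero_mul]
  have hae : (Function.uncurry fun z s => f (Φ.flow s z)) =ᵐ[μ.prod ν] G := by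
    refine (ae_iff.2 (measure_mono_null (fun p hp => ?_) hSc))
    intro hpS
    exact hp (by simp only [hG, hpS, dite_true]; rfl)
  have hint : Integrable (Function.uncurry fun z s => f (Φ.flow s z)) (μ.prod ν) :=
    hGint.congr hae.symm
  -- Fubini and stationarity
  simp_rw [intervalIntegral.integral_of_le hh.le]
  rw [integral_integral_swap hint]
  have hinv : ∀ s, ∫ z, f (Φ.flow s z) ∂μ = ∫ z, f z ∂μ := fun s =>
    integral_comp_flow_localGibbsLaw_const σ a θ u N Φ s hf.aestronglyMeasurable
  simp_rw [hinv]
  rw [setIntegral_const]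
  simp [Measure.real, Real.volume_Ioc, hh.le]

/-! ### B. One-body reductions under the homogeneous Gibbs law with drift -/

/-- One-body velocity expectations under the homogeneous Gibbs measure with constant profiles
`(a, u, θ)`, `a, θ > 0`, `σ ≤ 1/2`, are `gaussMeasure u θ` expectations, particle by particle. [folklore] -/
theorem lintegral_vel_localGibbsMeasure_const {σ : ℝ} (hσ : σ ≤ 1 / 2) {a θ : ℝ} (ha : 0 < a)
    (hθ : 0 < θ) (u : V3) (N : ℕ) (i : Fin (N + 1)) {H : V3 → ℝ≥0∞} (hH : Measurable H) :
    ∫⁻ z, H ((z i).2) ∂localGibbsMeasure σ (fun _ => a) (fun _ => u) (fun _ => θ) N =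
      ∫⁻ w, H w ∂gaussMeasure u θ := by
  haveI := isProbabilityMeasure_localGibbsMeasure (a₀ := fun _ : T3 => a)
    (θ₀ := fun _ : T3 => θ) (u₀ := fun _ : T3 => u) continuous_const continuous_const
    continuous_const (fun _ => ha) (fun _ => hθ) hσ N
  have hG : Measurable fun z : Config (N + 1) (Fin 3) T3 => H ((z i).2) :=
    hH.comp (measurable_pi_apply i).snd
  rw [lintegral_localGibbsMeasure (a₀ := fun _ : T3 => a) (θ₀ := fun _ : T3 => θ)
    (u₀ := fun _ : T3 => u) continuous_const continuous_const continuous_const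
    (fun _ => ha.le) (fun _ => hθ) σ N hG]
  have hinner : ∀ x : Fin (N + 1) → T3,
      ∫⁻ v, H ((zipConfig (x, v) i).2) ∂velMeasure (fun _ => u) (fun _ => θ) x =
        ∫⁻ w, H w ∂gaussMeasure u θ := by
    intro x
    have hmp : MeasurePreserving (Function.eval i)
        (velMeasure (fun _ => u) (fun _ => θ) x) (gaussMeasure u θ) := by
      unfold velMeasure
      exact measurePreserving_eval _ i
    rw [← hmp.lintegral_comp hH]
    rfl
  simp_rw [hinner]
  rw [lintegral_mul_const _ ?_, lintegral_posWeight_eq_one (a₀ := fun _ : T3 => a)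
    (θ₀ := fun _ : T3 => θ) (u₀ := fun _ : T3 => u) continuous_const continuous_const
    continuous_const (fun _ => ha.le) (fun _ => hθ) σ N, one_mul]
  exact ((measurable_posWeight continuous_const _ _).const_mul _).ennreal_ofReal

open KineticFluxLdDecayTilt (llr1 llr1_eq llrConfig measurable_llrConfig continuous_llr1
  localGibbsMeasure_ref_eq_withDensity ofReal_exp_integral_le_lintegral integral_eq_zero_of_odd_stdGaussian)

/-! ### B'. Integrability of polynomially bounded one-body observables -/

/-- The velocity of particle `i` pushes the homogeneous Gibbs measure to `gaussMeasure u θ`. [folklore] -/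
theorem measurePreserving_vel_localGibbsMeasure_const {σ : ℝ} (hσ : σ ≤ 1 / 2) {a θ : ℝ} (ha : 0 < a)
    (hθ : 0 < θ) (u : V3) (N : ℕ) (i : Fin (N + 1)) :
    MeasurePreserving (fun z : Config (N + 1) (Fin 3) T3 => (z i).2)
      (localGibbsMeasure σ (fun _ => a) (fun _ => u) (fun _ => θ) N) (gaussMeasure u θ) := by
  refine ⟨(measurable_pi_apply i).snd, Measure.ext fun s hs => ?_⟩
  rw [Measure.map_apply (measurable_pi_apply i).snd hs, ← lintegral_indicator_one hs,
    ← lintegral_indicator_one ((measurable_pi_apply i).snd hs),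
    ← lintegral_vel_localGibbsMeasure_const hσ ha hθ u N i (H := s.indicator 1)
      (measurable_one.indicator hs)]
  rfl

/-- `w ↦ (1 + ‖w‖²)^m` is integrable under the standard Gaussian (Fernique: all moments). [folklore] -/
theorem integrable_one_add_norm_sq_pow (m : ℕ) :
    Integrable (fun w : V3 => (1 + ‖w‖ ^ 2) ^ m) (stdGaussian V3) := by
  have hpow : Integrable (fun w : V3 => ‖w‖ ^ (2 * m)) (stdGaussian V3) := by
    rcases Nat.eq_zero_or_pos m with hm | hm
    · subst hm; simp
    · have h := (IsGaussian.memLp_id (stdGaussian V3) ((2 * m : ℕ) : ℝ≥0∞) (ENNReal.natCast_ne_top _)).integrable_norm_pow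
        (by omega)
      simpa using h
  have hdom : Integrable (fun w : V3 => 2 ^ m * (1 + ‖w‖ ^ (2 * m))) (stdGaussian V3) :=
    ((integrable_const (1 : ℝ)).add hpow).const_mul (2 ^ m)
  refine hdom.mono' (by fun_prop : Continuous fun w : V3 => (1 + ‖w‖ ^ 2) ^ m).aestronglyMeasurable
    (ae_of_all _ fun w => ?_)
  rw [Real.norm_eq_abs, abs_of_nonneg (by positivity), pow_mul]
  exact Literature.Analysis.FunctionSpaces.BMOInv.one_add_pow_le_two_pow_mul (sq_nonneg _) m

/-- `1 + ‖u + √θ w‖² ≤ (1 + 2‖u‖² + 2θ)(1 + ‖w‖²)`. [folklore] -/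
theorem one_add_norm_shift_sq_le (u w : V3) {θ : ℝ} (hθ : 0 < θ) :
    1 + ‖u + Real.sqrt θ • w‖ ^ 2 ≤ (1 + 2 * ‖u‖ ^ 2 + 2 * θ) * (1 + ‖w‖ ^ 2) := by
  have h1 : ‖u + Real.sqrt θ • w‖ ≤ ‖u‖ + Real.sqrt θ * ‖w‖ := by
    refine (norm_add_le _ _).trans ?_
    rw [norm_smul, Real.norm_eq_abs, abs_of_nonneg (Real.sqrt_nonneg θ)]
  have hsq : Real.sqrt θ ^ 2 = θ := Real.sq_sqrt hθ.le
  nlinarith [norm_nonneg (u + Real.sqrt θ • w), norm_nonneg u, Real.sqrt_nonneg θ, norm_nonneg w,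
    sq_nonneg (‖u‖ - Real.sqrt θ * ‖w‖), mul_nonneg (Real.sqrt_nonneg θ) (norm_nonneg w),
    mul_nonneg hθ.le (sq_nonneg ‖w‖), sq_nonneg ‖u‖, mul_nonneg (sq_nonneg ‖u‖) (sq_nonneg ‖w‖),
    mul_nonneg (mul_nonneg hθ.le (sq_nonneg ‖w‖)) (sq_nonneg ‖w‖)]

/-- A continuous `g` of polynomial growth `|g v| ≤ C (1 + ‖v‖²)^m` is integrable under every
`gaussMeasure u θ`, `θ > 0`. [folklore] -/
theorem integrable_gaussMeasure_of_growth {g : V3 → ℝ} (hg : Continuous g) {C : ℝ} {m : ℕ}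
    (hC : ∀ v, |g v| ≤ C * (1 + ‖v‖ ^ 2) ^ m) (u : V3) {θ : ℝ} (hθ : 0 < θ) :
    Integrable g (gaussMeasure u θ) := by
  rw [gaussMeasure, ← coe_gaussShiftEquiv u hθ]
  refine (integrable_map_equiv (gaussShiftEquiv u hθ) g).2 ?_
  have hC0 : 0 ≤ C := by
    have h0 := (abs_nonneg _).trans (hC 0)
    have : 0 < ((1 : ℝ) + ‖(0 : V3)‖ ^ 2) ^ m := by positivity
    nlinarith
  set c : ℝ := 1 + 2 * ‖u‖ ^ 2 + 2 * θ with hc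
  have hdom : Integrable (fun w : V3 => C * c ^ m * (1 + ‖w‖ ^ 2) ^ m) (stdGaussian V3) :=
    (integrable_one_add_norm_sq_pow m).const_mul _
  refine hdom.mono' (hg.measurable.comp (gaussShiftEquiv u hθ).measurable).aestronglyMeasurable
    (ae_of_all _ fun w => ?_)
  rw [Function.comp_apply, coe_gaussShiftEquiv, Real.norm_eq_abs]
  refine (hC _).trans ?_
  rw [mul_assoc, ← mul_pow]
  refine mul_le_mul_of_nonneg_left (pow_le_pow_left₀ (by positivity) ?_ m) hC0
  exact one_add_norm_shift_sq_le u w hθ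

/-- One-body observables of polynomial growth are integrable under the homogeneous Gibbs measure. [folklore] -/
theorem integrable_vel_localGibbsMeasure_const {σ : ℝ} (hσ : σ ≤ 1 / 2) {a θ : ℝ} (ha : 0 < a)
    (hθ : 0 < θ) (u : V3) (N : ℕ) (i : Fin (N + 1)) {g : V3 → ℝ} (hg : Continuous g) {C : ℝ} {m : ℕ}
    (hC : ∀ v, |g v| ≤ C * (1 + ‖v‖ ^ 2) ^ m) :
    Integrable (fun z : Config (N + 1) (Fin 3) T3 => g ((z i).2))
      (localGibbsMeasure σ (fun _ => a) (fun _ => u) (fun _ => θ) N) :=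
  (measurePreserving_vel_localGibbsMeasure_const hσ ha hθ u N i).integrable_comp
    hg.aestronglyMeasurable |>.2 (integrable_gaussMeasure_of_growth hg hC u hθ)

/-- `∫ g(vᵢ) dG_N = ∫ g d(gaussMeasure u θ)` (Bochner form of the one-body reduction). [folklore] -/
theorem integral_vel_localGibbsMeasure_const {σ : ℝ} (hσ : σ ≤ 1 / 2) {a θ : ℝ} (ha : 0 < a)
    (hθ : 0 < θ) (u : V3) (N : ℕ) (i : Fin (N + 1)) {g : V3 → ℝ} (hg : Continuous g) :
    ∫ z, g ((z i).2) ∂localGibbsMeasure σ (fun _ => a) (fun _ => u) (fun _ => θ) N =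
      ∫ w, g w ∂gaussMeasure u θ := by
  have h := measurePreserving_vel_localGibbsMeasure_const hσ ha hθ u N i
  have hg' : AEStronglyMeasurable g
      ((localGibbsMeasure σ (fun _ => a) (fun _ => u) (fun _ => θ) N).map
        (fun z : Config (N + 1) (Fin 3) T3 => (z i).2)) := by
    rw [h.map_eq]; exact hg.aestronglyMeasurable
  rw [← integral_map (measurable_pi_apply i).snd.aemeasurable hg', h.map_eq]

/-- Powers of the kinetic energy are integrable under the homogeneous Gibbs measure:
`z ↦ (1 + 2E(z))^m` (power-mean inequality + one-body Gaussian moments). [folklore] -/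
theorem integrable_one_add_two_mul_configEnergy_pow {σ : ℝ} (hσ : σ ≤ 1 / 2) {a θ : ℝ} (ha : 0 < a)
    (hθ : 0 < θ) (u : V3) (N : ℕ) (m : ℕ) :
    Integrable (fun z : Config (N + 1) (Fin 3) T3 => (1 + 2 * configEnergy z) ^ m)
      (localGibbsMeasure σ (fun _ => a) (fun _ => u) (fun _ => θ) N) := by
  -- domination by `(N+1)^m ∑ᵢ (1 + ‖vᵢ‖²)^m`
  have hterm : ∀ i : Fin (N + 1), Integrable (fun z : Config (N + 1) (Fin 3) T3 => (1 + ‖(z i).2‖ ^ 2) ^ m)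
      (localGibbsMeasure σ (fun _ => a) (fun _ => u) (fun _ => θ) N) := fun i =>
    integrable_vel_localGibbsMeasure_const hσ ha hθ u N i (g := fun v : V3 => (1 + ‖v‖ ^ 2) ^ m) (by fun_prop)
      (C := 1) (m := m) (fun v => by rw [abs_of_nonneg (by positivity), one_mul])
  have hdom : Integrable (fun z : Config (N + 1) (Fin 3) T3 => ((N : ℝ) + 1) ^ m * ∑ i, (1 + ‖(z i).2‖ ^ 2) ^ m)
      (localGibbsMeasure σ (fun _ => a) (fun _ => u) (fun _ => θ) N) :=
    (integrable_finsetSum Finset.univ fun i _ => hterm i).const_mul _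
  refine hdom.mono' (by unfold configEnergy; fun_prop : Continuous fun z : Config (N + 1) (Fin 3) T3 =>
    (1 + 2 * configEnergy z) ^ m).aestronglyMeasurable (ae_of_all _ fun z => ?_)
  rw [Real.norm_eq_abs, abs_of_nonneg (by unfold configEnergy; positivity)]
  have hE : 1 + 2 * configEnergy z ≤ ∑ i, (1 + ‖(z i).2‖ ^ 2) := by
    rw [configEnergy, ← mul_assoc, mul_inv_cancel₀ two_ne_zero, one_mul, Finset.sum_add_distrib,
      Finset.sum_const, Finset.card_univ, Fintype.card_fin]
    simp only [nsmul_eq_mul, mul_one]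
    have : (0 : ℝ) ≤ (N : ℝ) := Nat.cast_nonneg N
    push_cast
    linarith
  have hnn : ∀ i ∈ (Finset.univ : Finset (Fin (N + 1))), (0 : ℝ) ≤ 1 + ‖(z i).2‖ ^ 2 := fun i _ => by positivity
  have h1 : (1 + 2 * configEnergy z) ^ m ≤ (∑ i, (1 + ‖(z i).2‖ ^ 2)) ^ m :=
    pow_le_pow_left₀ (by unfold configEnergy; positivity) hE m
  refine h1.trans ?_
  rcases Nat.eq_zero_or_pos m with hm | hm
  · subst hm
    simp
  · obtain ⟨n, rfl⟩ : ∃ n, m = n + 1 := ⟨m - 1, by omega⟩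
    have h2 := pow_sum_le_card_mul_sum_pow hnn n
    rw [Finset.card_univ, Fintype.card_fin] at h2
    refine h2.trans ?_
    push_cast
    refine mul_le_mul_of_nonneg_right (pow_le_pow_right₀ ?_ (Nat.le_succ n)) ?_
    · have : (1 : ℝ) ≤ (N : ℝ) + 1 := by
        have : (0 : ℝ) ≤ N := Nat.cast_nonneg N
        linarith
      exact this
    · exact Finset.sum_nonneg fun i _ => by positivity

end KineticCurrentsWindowTilt
end Summit.AtomisticToContinuum.HydrodynamicLimit.Theorems

end
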